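import Mathlib
import Literature.Analysis.Calculus.IntervalCauchySchwarz

/-!
# Route PhotonSphereChannels — near-channel estimate: Hardy on a half-line and the final arithmetic

Helper file for `PhotonSphereChannelsNearChannels.lean` (item `FixedModeChannels`,
stmt-FinalStateConjecture-10048): the set-integral (improper) form of the weighted Hardy/Poincaré
inequality `∫_{−∞}^a V h² ≤ C_V ∫_{−∞}^a h'²` for `h(a) = 0` (from the interval form
`Literature.Analysis.Calculus.intervalIntegral_mul_sq_le_of_apply_eq_zero` by `b → −∞`), the
elementary `(u − v)² ≤ 2u² + 2v²`, and the closing arithmetic of the near estimate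
(`η = 1/4`, Hardy constant `≤ 1/6400`, `σ² ≤ 1/1600` give a coefficient `≥ 1/4`).
-/

noncomputable section

namespace Summit.FinalStateConjecture.FinalStateConjecture.Theorems

open Literature.Analysis.Calculus MeasureTheory Real Set Filter Topology

/-- `(u − v)² ≤ 2u² + 2v²`. -/
theorem sub_sq_le_two_mul (u v : ℝ) : (u - v) ^ 2 ≤ 2 * u ^ 2 + 2 * v ^ 2 := by
  nlinarith [sq_nonneg (u + v)]

/-- The final arithmetic of the near estimate: with `η = 1/4`, Hardy constant `≤ 1/6400` and
`σ² ≤ 1/1600`, the two one-sided bounds add up to at least `EV/4`. -/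
theorem near_final_arith {EV Ef Ip Im S : ℝ} (hEV : 0 ≤ EV) (hS : S ≤ 1 / 1600)
    (hsum : Ip + Im = Ef) (hHardy : EV ≤ (1 + 1 / 6400) * Ef) :
    EV / 4 ≤ (Ip / (1 + 1 / 4) ^ 2 - 4 * S * EV / (1 / 4 * (1 + 1 / 4)))
      + (Im / (1 + 1 / 4) ^ 2 - 4 * S * EV / (1 / 4 * (1 + 1 / 4))) := by
  have h1 : (Ip / (1 + 1 / 4) ^ 2 - 4 * S * EV / (1 / 4 * (1 + 1 / 4)))
      + (Im / (1 + 1 / 4) ^ 2 - 4 * S * EV / (1 / 4 * (1 + 1 / 4)))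
      = 16 / 25 * Ef - 128 / 5 * (S * EV) := by rw [← hsum]; ring
  rw [h1]
  nlinarith [mul_le_mul_of_nonneg_right hS hEV]

/-- **Hardy on a half-line, set-integral form**: for `V ≥ 0` continuous with
`∫_{−∞}^a (a − y)V ≤ C_V`, `h ∈ C¹` with `h(a) = 0`, and `h'²`, `Vh²` integrable on `(−∞, a]`:
`∫_{−∞}^a V h² ≤ C_V ∫_{−∞}^a h'²`. -/
theorem setIntegral_Iic_hardy {V h : ℝ → ℝ} (hV : Continuous V) (hV0 : ∀ x, 0 ≤ V x) {a CV : ℝ}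
    (hW : IntegrableOn (fun y => (a - y) * V y) (Iic a)) (hCV : ∫ y in Iic a, (a - y) * V y ≤ CV)
    (hh : ContDiff ℝ 1 h) (h0 : h a = 0) (hh'i : IntegrableOn (fun x => deriv h x ^ 2) (Iic a))
    (hVhi : IntegrableOn (fun x => V x * h x ^ 2) (Iic a)) :
    ∫ x in Iic a, V x * h x ^ 2 ≤ CV * ∫ x in Iic a, deriv h x ^ 2 := by
  have hhd : ∀ x, HasDerivAt h (deriv h x) x := fun x => (hh.differentiable (by norm_num) x).hasDerivAt
  have hh'c : Continuous (deriv h) := hh.continuous_deriv le_rfl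
  have hD0 : 0 ≤ ∫ x in Iic a, deriv h x ^ 2 := setIntegral_nonneg measurableSet_Iic fun x _ => sq_nonneg _
  have hlim := intervalIntegral_tendsto_integral_Iic a hVhi tendsto_id
  refine le_of_tendsto hlim ?_
  filter_upwards [eventually_le_atBot a] with b hb
  have h1 := intervalIntegral_mul_sq_le_of_apply_eq_zero hV hV0 hhd hh'c hb h0
  have h2 : (∫ x in b..a, (a - x) * V x) ≤ CV := by
    refine le_trans ?_ hCV
    rw [intervalIntegral.integral_of_le hb]
    exact setIntegral_mono_set hW (ae_restrict_of_forall_mem measurableSet_Iic fun y hy =>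
      mul_nonneg (sub_nonneg.2 hy) (hV0 y)) (ae_of_all _ Ioc_subset_Iic_self)
  have h3 : (∫ x in b..a, deriv h x ^ 2) ≤ ∫ x in Iic a, deriv h x ^ 2 := by
    rw [intervalIntegral.integral_of_le hb]
    exact setIntegral_mono_set hh'i (ae_of_all _ fun x => sq_nonneg _) (ae_of_all _ Ioc_subset_Iic_self)
  have h4 : 0 ≤ ∫ x in b..a, deriv h x ^ 2 := intervalIntegral.integral_nonneg hb fun x _ => sq_nonneg _
  have h5 : 0 ≤ ∫ x in b..a, (a - x) * V x := intervalIntegral.integral_nonneg hb fun x hx =>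
    mul_nonneg (by linarith [hx.2]) (hV0 x)
  calc (∫ x in b..a, V x * h x ^ 2) ≤ (∫ x in b..a, (a - x) * V x) * ∫ x in b..a, deriv h x ^ 2 := h1
    _ ≤ CV * ∫ x in Iic a, deriv h x ^ 2 := mul_le_mul h2 h3 h4 ((h5.trans h2))

end Summit.FinalStateConjecture.FinalStateConjecture.Theorems
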